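import Literature.Analysis.Fourier.ConvolutionOperatorSymbol
import HarnessLib

/-!
# Translation-invariant matrices on a finite abelian group, II: full Fourier inversion and
# lattice gradients (finite differences) of convolution kernels

Companion of `ConvolutionOperatorSymbol.lean` (`IsTranslationInvariant`, `symbol`).  There the
Fourier inversion was proved at the origin only (`sum_symbol`: `Σ_ψ σ_A(ψ) = |G|·A 0 0`), which
suffices for kernel bounds of POSITIVE SEMIDEFINITE convolution operators (`|A x y| ≤ A 0 0`).
Multiscale (renormalisation-group) estimates need the kernel entries of DERIVATIVES of the pieces
of a finite-range decomposition, `∇^α C(x,y)`, which are neither positive nor diagonal-dominated;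
this file supplies the plane-wave calculus for them:

* **full Fourier inversion** `Σ_ψ σ_A(ψ)·ψ(x − y) = |G|·A x y` (`sum_symbol_mul_addChar`) and the
  resulting **`ℓ¹`-symbol kernel bound** `|A x y| ≤ |G|⁻¹ Σ_ψ ‖σ_A(ψ)‖` (`abs_apply_le_avg_norm_symbol`)
  for EVERY translation-invariant real matrix;
* the **forward difference in the first index** `rowDiff g A x y = A (x+g) y − A x y` and in the
  second index `colDiff g A x y = A x (y+g) − A x y` (`= rowDiff (−g) A` for translation-invariant `A`),
  iterated along a list of steps (`rowDiffs`), all translation invariant, with the **symbols**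
  `σ_{rowDiff g A}(ψ) = (ψ(g) − 1)·σ_A(ψ)`, `σ_{rowDiffs l A}(ψ) = Π_{g∈l}(ψ(g) − 1)·σ_A(ψ)`;
* the **gradient kernel bound**
  `|rowDiffs l A x y| ≤ |G|⁻¹ Σ_ψ (Π_{g∈l} ‖ψ(g) − 1‖)·‖σ_A(ψ)‖` (`abs_rowDiffs_apply_le`), together with
  `‖ψ(g) − 1‖² = 2 − 2 Re ψ(g)` and `‖ψ(g) − 1‖ ≤ 2` — each lattice derivative costs one factor of the
  (small) momentum `‖ψ(g) − 1‖ = 2|sin(p·g/2)|` under the momentum sum.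

Standard finite Fourier analysis of circulant/convolution operators, e.g.
[cite: BauerschmidtBrydgesSlade2019, §1.5.1 (lattice Green function in Fourier variables)] and, for
the role of the gradient factors in covariance estimates,
[cite: Bauerschmidt2013, Thm. 1.2 (bounds on `∇^α` of finite-range pieces)]; all statements are
[folklore].
-/

noncomputable section

open Finset
open scoped ComplexConjugate

namespace Literature.Analysis.Fourier

variable {G : Type*} [AddCommGroup G]

/-! ## Finite differences of a kernel -/

/-- Forward difference in the FIRST index along the step `g`: `(∇_g A)(x,y) = A(x+g,y) − A(x,y)`.
[folklore] -/
def rowDiff (g : G) (A : Matrix G G ℝ) : Matrix G G ℝ := fun x y => A (x + g) y - A x y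

/-- Forward difference in the SECOND index along the step `g`: `A(x,y+g) − A(x,y)`. [folklore] -/
def colDiff (g : G) (A : Matrix G G ℝ) : Matrix G G ℝ := fun x y => A x (y + g) - A x y

/-- Iterated forward differences in the first index along a list of steps (outermost first):
`rowDiffs [g₁,…,gₐ] A = ∇_{g₁} ⋯ ∇_{gₐ} A`. [folklore] -/
def rowDiffs : List G → Matrix G G ℝ → Matrix G G ℝ
  | [], A => A
  | g :: l, A => rowDiff g (rowDiffs l A)

/-- Entries of the forward difference. [folklore] -/
@[simp] theorem rowDiff_apply (g : G) (A : Matrix G G ℝ) (x y : G) :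
    rowDiff g A x y = A (x + g) y - A x y := rfl

/-- Entries of the difference in the second index. [folklore] -/
@[simp] theorem colDiff_apply (g : G) (A : Matrix G G ℝ) (x y : G) :
    colDiff g A x y = A x (y + g) - A x y := rfl

/-- No difference. [folklore] -/
@[simp] theorem rowDiffs_nil (A : Matrix G G ℝ) : rowDiffs [] A = A := rfl

/-- One more difference. [folklore] -/
@[simp] theorem rowDiffs_cons (g : G) (l : List G) (A : Matrix G G ℝ) :
    rowDiffs (g :: l) A = rowDiff g (rowDiffs l A) := rfl

/-- `∇_g` is additive in the kernel. [folklore] -/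
theorem rowDiff_add (g : G) (A B : Matrix G G ℝ) : rowDiff g (A + B) = rowDiff g A + rowDiff g B := by
  ext x y; simp only [rowDiff_apply, Matrix.add_apply]; ring

/-- `∇_g` is homogeneous in the kernel. [folklore] -/
theorem rowDiff_smul (g : G) (c : ℝ) (A : Matrix G G ℝ) : rowDiff g (c • A) = c • rowDiff g A := by
  ext x y; simp only [rowDiff_apply, Matrix.smul_apply, smul_eq_mul]; ring

/-- `∇_g` of a finite sum of kernels. [folklore] -/
theorem rowDiff_sum {ι : Type*} (g : G) (s : Finset ι) (F : ι → Matrix G G ℝ) :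
    rowDiff g (∑ k ∈ s, F k) = ∑ k ∈ s, rowDiff g (F k) := by
  ext x y
  simp only [rowDiff_apply, Matrix.sum_apply, Finset.sum_sub_distrib]

/-- Iterated differences of a finite sum of kernels. [folklore] -/
theorem rowDiffs_sum {ι : Type*} (l : List G) (s : Finset ι) (F : ι → Matrix G G ℝ) :
    rowDiffs l (∑ k ∈ s, F k) = ∑ k ∈ s, rowDiffs l (F k) := by
  induction l with
  | nil => rfl
  | cons g l ih => rw [rowDiffs_cons, ih, rowDiff_sum]; rfl

/-- Iterated differences are homogeneous. [folklore] -/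
theorem rowDiffs_smul (l : List G) (c : ℝ) (A : Matrix G G ℝ) : rowDiffs l (c • A) = c • rowDiffs l A := by
  induction l with
  | nil => rfl
  | cons g l ih => rw [rowDiffs_cons, ih, rowDiff_smul]; rfl

namespace IsTranslationInvariant

variable {A : Matrix G G ℝ}

/-- `∇_g` preserves translation invariance. [folklore] -/
theorem rowDiff (hA : IsTranslationInvariant A) (g : G) : IsTranslationInvariant (rowDiff g A) := by
  intro h x y
  simp only [rowDiff_apply]
  rw [add_right_comm x h g, hA h (x + g) y, hA h x y]

/-- The difference in the second index preserves translation invariance. [folklore] -/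
theorem colDiff (hA : IsTranslationInvariant A) (g : G) : IsTranslationInvariant (colDiff g A) := by
  intro h x y
  simp only [colDiff_apply]
  rw [add_right_comm y h g, hA h x (y + g), hA h x y]

/-- Iterated differences preserve translation invariance. [folklore] -/
theorem rowDiffs (hA : IsTranslationInvariant A) (l : List G) : IsTranslationInvariant (rowDiffs l A) := by
  induction l with
  | nil => exact hA
  | cons g l ih => exact ih.rowDiff g

/-- For a translation-invariant kernel a difference in the second index is a difference in the
first index along the opposite step: `A(x,y+g) − A(x,y) = A(x−g,y) − A(x,y)`. [folklore] -/
theorem colDiff_eq_rowDiff_neg (hA : IsTranslationInvariant A) (g : G) :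
    _root_.Literature.Analysis.Fourier.colDiff g A = _root_.Literature.Analysis.Fourier.rowDiff (-g) A := by
  ext x y
  simp only [colDiff_apply, rowDiff_apply]
  have h := hA g (x + -g) y
  rw [neg_add_cancel_right] at h
  rw [h]

end IsTranslationInvariant

/-! ## Symbols of differences -/

variable [Fintype G]

variable {A : Matrix G G ℝ} (ψ : AddChar G ℂ)

/-- **Symbol of a forward difference**: `σ_{∇_g A}(ψ) = (ψ(g) − 1)·σ_A(ψ)`. [folklore] -/
theorem symbol_rowDiff (hA : IsTranslationInvariant A) (g : G) :
    symbol (rowDiff g A) ψ = (ψ g - 1) * symbol A ψ := by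
  unfold symbol
  simp only [rowDiff_apply, Complex.ofReal_sub, sub_mul, Finset.sum_sub_distrib, one_mul]
  congr 1
  -- `Σ_y A g y ψ y = ψ g Σ_w A 0 w ψ w`  (substitute `y = w + g`, `A g (w+g) = A 0 w`)
  rw [Finset.mul_sum]
  symm
  refine Fintype.sum_equiv (Equiv.addRight g) _ _ fun w => ?_
  simp only [Equiv.coe_addRight]
  have h := hA g 0 w
  rw [zero_add] at h
  rw [zero_add, h, AddChar.map_add_eq_mul]
  ring

/-- **Symbol of iterated differences**: `σ_{∇_{g₁}⋯∇_{gₐ}A}(ψ) = Π_i (ψ(g_i) − 1) · σ_A(ψ)`. [folklore] -/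
theorem symbol_rowDiffs (hA : IsTranslationInvariant A) (l : List G) :
    symbol (rowDiffs l A) ψ = (l.map fun g => (ψ g - 1)).prod * symbol A ψ := by
  induction l with
  | nil => simp
  | cons g l ih =>
    rw [rowDiffs_cons, symbol_rowDiff ψ (hA.rowDiffs l) g, ih, List.map_cons, List.prod_cons]
    ring

/-- Symbol of a difference in the second index: `σ(ψ) = (ψ(−g) − 1)·σ_A(ψ)`. [folklore] -/
theorem symbol_colDiff (hA : IsTranslationInvariant A) (g : G) :
    symbol (colDiff g A) ψ = (ψ (-g) - 1) * symbol A ψ := by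
  rw [hA.colDiff_eq_rowDiff_neg g, symbol_rowDiff ψ hA (-g)]

/-- `‖ψ(g) − 1‖² = 2 − 2 Re ψ(g)` (unimodularity of characters). [folklore] -/
theorem norm_addChar_sub_one_sq (g : G) : ‖ψ g - 1‖ ^ 2 = 2 - 2 * (ψ g).re := by
  rw [Complex.sq_norm, Complex.normSq_apply]
  simp only [Complex.sub_re, Complex.one_re, Complex.sub_im, Complex.one_im, sub_zero]
  have h1 : (ψ g).re * (ψ g).re + (ψ g).im * (ψ g).im = 1 := by
    have h := AddChar.norm_apply ψ g
    rw [Complex.norm_def, Real.sqrt_eq_one, Complex.normSq_apply] at h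
    exact h
  nlinarith [h1]

/-- `‖ψ(g) − 1‖ ≤ 2`. [folklore] -/
theorem norm_addChar_sub_one_le (g : G) : ‖ψ g - 1‖ ≤ 2 := by
  calc ‖ψ g - 1‖ ≤ ‖ψ g‖ + ‖(1 : ℂ)‖ := norm_sub_le _ _
    _ = 2 := by rw [AddChar.norm_apply, norm_one]; norm_num

/-- `‖ψ(−g) − 1‖ = ‖ψ(g) − 1‖`. [folklore] -/
theorem norm_addChar_neg_sub_one (g : G) : ‖ψ (-g) - 1‖ = ‖ψ g - 1‖ := by
  rw [AddChar.map_neg_eq_conj, ← Complex.norm_conj (ψ g - 1), map_sub, map_one]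

/-! ## Full Fourier inversion and the `ℓ¹`-symbol kernel bound -/

/-- **Fourier inversion**: `Σ_ψ σ_A(ψ)·ψ(x − y) = |G| · A x y` for every translation-invariant
real matrix `A`. [folklore] -/
theorem sum_symbol_mul_addChar [DecidableEq G] (hA : IsTranslationInvariant A) (x y : G) :
    ∑ ψ : AddChar G ℂ, symbol A ψ * ψ (x - y) = Fintype.card G * (A x y : ℂ) := by
  unfold symbol
  simp only [Finset.sum_mul]
  rw [Finset.sum_comm]
  have key : ∀ w : G, ∑ ψ : AddChar G ℂ, (A 0 w : ℂ) * ψ w * ψ (x - y)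
      = (A 0 w : ℂ) * ∑ ψ : AddChar G ℂ, ψ (w + (x - y)) := by
    intro w
    rw [Finset.mul_sum]
    refine Finset.sum_congr rfl fun ψ _ => ?_
    rw [AddChar.map_add_eq_mul]; ring
  simp_rw [key, AddChar.sum_apply_eq_ite]
  rw [Finset.sum_eq_single (y - x)]
  · rw [if_pos (by abel), hA.apply_eq x y]; ring
  · intro w _ hw
    rw [if_neg, mul_zero]
    intro h; apply hw
    have : w = -(x - y) := eq_neg_of_add_eq_zero_left h
    rw [this]; abel
  · intro h; exact absurd (Finset.mem_univ _) h

/-- **Fourier inversion, solved for the kernel**: `A x y = |G|⁻¹ Σ_ψ σ_A(ψ) ψ(x − y)`. [folklore] -/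
theorem apply_eq_avg_symbol_mul_addChar [DecidableEq G] (hA : IsTranslationInvariant A) (x y : G) :
    (A x y : ℂ) = (Fintype.card G : ℂ)⁻¹ * ∑ ψ : AddChar G ℂ, symbol A ψ * ψ (x - y) := by
  rw [sum_symbol_mul_addChar hA x y, ← mul_assoc, inv_mul_cancel₀, one_mul]
  exact Nat.cast_ne_zero.mpr Fintype.card_ne_zero

/-- **`ℓ¹`-symbol kernel bound**: `|A x y| ≤ |G|⁻¹ Σ_ψ ‖σ_A(ψ)‖` for every translation-invariant real
matrix (no positivity needed). [folklore] -/
theorem abs_apply_le_avg_norm_symbol [DecidableEq G] (hA : IsTranslationInvariant A) (x y : G) :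
    |A x y| ≤ (Fintype.card G : ℝ)⁻¹ * ∑ ψ : AddChar G ℂ, ‖symbol A ψ‖ := by
  have h := congrArg norm (apply_eq_avg_symbol_mul_addChar hA x y)
  rw [Complex.norm_real, Real.norm_eq_abs] at h
  rw [h, norm_mul, norm_inv, Complex.norm_natCast]
  refine mul_le_mul_of_nonneg_left ?_ (inv_nonneg.mpr (Nat.cast_nonneg _))
  refine (norm_sum_le _ _).trans (Finset.sum_le_sum fun ψ _ => ?_)
  rw [norm_mul, AddChar.norm_apply, mul_one]

/-- **Gradient kernel bound**: each forward difference along `g` costs a factor `‖ψ(g) − 1‖` under the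
momentum sum — `|∇_{g₁}⋯∇_{gₐ} A (x,y)| ≤ |G|⁻¹ Σ_ψ (Π_i ‖ψ(g_i) − 1‖)·‖σ_A(ψ)‖`.
[cite: Bauerschmidt2013, Thm. 1.2 (the `∇^α` bounds of finite-range pieces are momentum integrals with
`|α|` extra powers of the momentum)] -/
theorem abs_rowDiffs_apply_le [DecidableEq G] (hA : IsTranslationInvariant A) (l : List G) (x y : G) :
    |rowDiffs l A x y|
      ≤ (Fintype.card G : ℝ)⁻¹ * ∑ ψ : AddChar G ℂ, (l.map fun g => ‖ψ g - 1‖).prod * ‖symbol A ψ‖ := by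
  refine (abs_apply_le_avg_norm_symbol (hA.rowDiffs l) x y).trans (le_of_eq ?_)
  congr 1
  refine Finset.sum_congr rfl fun ψ _ => ?_
  rw [symbol_rowDiffs ψ hA l, norm_mul, List.norm_prod, List.map_map]
  rfl

/-- Gradient kernel bound for a REAL symbol written with `Re`: if `σ_A(ψ)` is real and nonnegative for
all `ψ` (e.g. `A` symmetric positive semidefinite), then
`|∇_{g₁}⋯∇_{gₐ} A (x,y)| ≤ |G|⁻¹ Σ_ψ (Π_i ‖ψ(g_i) − 1‖)·Re σ_A(ψ)`. [folklore] -/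
theorem abs_rowDiffs_apply_le_of_re [DecidableEq G] (hA : IsTranslationInvariant A)
    (hre : ∀ ψ : AddChar G ℂ, (symbol A ψ).im = 0) (hnn : ∀ ψ : AddChar G ℂ, 0 ≤ (symbol A ψ).re)
    (l : List G) (x y : G) :
    |rowDiffs l A x y|
      ≤ (Fintype.card G : ℝ)⁻¹ * ∑ ψ : AddChar G ℂ, (l.map fun g => ‖ψ g - 1‖).prod * (symbol A ψ).re := by
  refine (abs_rowDiffs_apply_le hA l x y).trans (le_of_eq ?_)
  congr 1
  refine Finset.sum_congr rfl fun ψ _ => ?_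
  congr 1
  have h : symbol A ψ = ((symbol A ψ).re : ℂ) := Complex.ext (by simp) (by simp [hre ψ])
  rw [h, Complex.norm_real, Real.norm_eq_abs, abs_of_nonneg (hnn ψ), Complex.ofReal_re]

end Literature.Analysis.Fourier

end
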